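import Literature.NumberTheory.EllipticCurves.TianYuanZhang2017.GenusPointDescentDisplays
import Mathlib.GroupTheory.OrderOfElement
import HarnessLib

/-!
# The `4`-torsion of Tian–Yuan–Zhang's curve `A : Y² = X³ + 4X` over a field containing `i` and `√2`:
# exactly sixteen points — the «`A(ℍ′_n)_tor = A[4]`» half «`A[4] ⊆ A(ℍ′_n)`» of Lemma 3.18 (`n` even) in the kernel

Cell `bsd-monsky` (typer seat g17; run/shared/lean/pub/bsd-monsky/). HONEST FRAMING (README §1): pure algebra on the
curve `A : Y² = X³ + 4X` (`curveA`, the tree's model of [TianYuanZhang2017]'s `A : 2y² = x³ + x`) over an arbitrary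
field `H` of characteristic `0` containing a square root `im` of `−1` and a square root `s` of `2`; nothing is asserted
about BSD, nothing booked, no named fact. It is the kernel content of the sentence «`#A(ℍ′_n)[4] = 16`» — the half
«`A[4] ⊆ A(ℍ′_n)`» of Lemma 3.18's «`A(ℍ′_n)_tor = A[4]` if `n` is even» as displayed by `GenusPointData.lemma318`
(`Nat.card {Q : APoint D.H // 4 • Q = 0} = 16`) — which the displayed data already imply: for `n` even, `i ∈ ℍ′_n` and
`√−2 ∈ ℍ′_n` (`2 ∣ n`), so `√2 = i·√−2 ∈ ℍ′_n` and `ℚ(ζ₈) = ℚ(i, √2) ⊂ ℍ′_n`, the field of definition of `A[4]`.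

## What is proved (kernel), and how

* `two_nsmul_some_eq_zero_iff`: an affine point `(x, y)` is `2`-torsion iff `y = 0`; `two_torsion_cases`: then
  `x ∈ {0, 2i, −2i}` (`x(x² + 4) = 0`). So `A(H)[2] = {O, (0, 0), (2i, 0), (−2i, 0)}` — the tree's `τ(1) = (0, 0)`
  and the two points `ptTwoI`, `ptNegTwoI` — and `Nat.card A(H)[2] ≤ 4` (`Fin 4` maps onto it).
* The three halves: `τ(1/2) = (2, 4)` with `2τ(1/2) = τ(1)` (the display's `two_nsmul_tauHalf`);
  `ptQ = (2i(1 + √2), (2√2 + 4)(1 − i))` with `2·ptQ = (2i, 0)` (`two_nsmul_ptQ`: the tangent has slope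
  `ℓ = −(1 + √2)(1 + i)`, `ℓ² − 2x = 2i`, `ℓ(2i − x) + y = 0`); and `[i]·ptQ` with `2·[i]·ptQ = [i](2i, 0) = (−2i, 0)`
  (`[i]` is additive, `cmI`).
* Upper bound: `Q ↦ (2Q, Q − base(2Q))` is an injection `A(H)[4] → A(H)[2] × A(H)[2]` (`base` picks the half above),
  so `Nat.card A(H)[4] ≤ 16` (`four_torsion_card_le`).
* Lower bound: `τ(1/2)` and `ptQ` have additive order exactly `4` and generate subgroups meeting only in `O`
  (their multiples have `X`-coordinates `2, 0` resp. `2i(1 + √2), 2i`, all distinct), so `(a, b) ↦ a·τ(1/2) + b·ptQ`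
  is an injection `Fin 4 × Fin 4 → A(H)[4]` (`injective_nsmul_add_nsmul_of_addOrderOf_four`, an abstract lemma on
  additive groups) and `16 ≤ Nat.card A(H)[4]` (`four_torsion_card_ge`).
* `card_four_torsion_eq_sixteen`: `Nat.card {Q : APoint H // 4 • Q = 0} = 16` for every field `H` of characteristic
  `0` with `im² = −1`, `s² = 2`; `card_four_torsion_of_data`: the same for `D.H`, `n` even, from the data's `i` and
  `√−2` alone.

[cite: TianYuanZhang2017, Lemma 3.16 (p0017 L98–L113), Lemma 3.18 (p0017 L152–L153), §3.2 (p0011 L121–L128, p0012 L1–L18)]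
[cite: SilvermanAEC2009, III.2.3]
-/

noncomputable section

open scoped Classical

open WeierstrassCurve WeierstrassCurve.Affine

namespace Literature.NumberTheory.EllipticCurves.TianYuanZhang2017

/-! ## §1 An abstract lemma: two elements of order `4` with trivial joint relations span `16` elements -/

section Abstract

variable {G : Type*} [AddCommGroup G]

/-- **Sixteen elements from two elements of order `4`**: if `x`, `y` have additive order `4` and `k • x = l • y` with
`k, l < 4` forces `k = 0`, then `(a, b) ↦ a • x + b • y` is injective on `Fin 4 × Fin 4`.
[cite: SilvermanAEC2009, III.6.4 (the structure of `E[m]`)] -/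
theorem injective_nsmul_add_nsmul_of_addOrderOf_four {x y : G} (hx : addOrderOf x = 4) (hy : addOrderOf y = 4)
    (hxy : ∀ k l : ℕ, k < 4 → l < 4 → k • x = l • y → k = 0) :
    Function.Injective (fun p : Fin 4 × Fin 4 => (p.1 : ℕ) • x + (p.2 : ℕ) • y) := by
  rintro ⟨a, b⟩ ⟨a', b'⟩ h
  simp only at h
  have h4x : (4 : ℕ) • x = 0 := by rw [← hx]; exact addOrderOf_nsmul_eq_zero x
  have h4y : (4 : ℕ) • y = 0 := by rw [← hy]; exact addOrderOf_nsmul_eq_zero y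
  -- `(a + 4 − a') • x = (b' + 4 − b) • y`
  have key : (a.val + 4 - a'.val) • x = (b'.val + 4 - b.val) • y := by
    have e1 : (a.val + 4 - a'.val) • x = (a.val • x + b.val • y) + ((4 - a'.val) • x + (4 - b.val) • y) -
        ((4 : ℕ) • y) := by
      have : (4 - a'.val) • x + a'.val • x = (4 : ℕ) • x := by
        rw [← add_nsmul, Nat.sub_add_cancel (by omega)]
      have h' : a.val • x + (4 - a'.val) • x = (a.val + 4 - a'.val) • x := by
        rw [← add_nsmul]; congr 1; omega
      have h'' : (4 - b.val) • y + b.val • y = (4 : ℕ) • y := by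
        rw [← add_nsmul, Nat.sub_add_cancel (by omega)]
      rw [← h', ← h'']; abel
    have e2 : (b'.val + 4 - b.val) • y = (a'.val • x + b'.val • y) + ((4 - a'.val) • x + (4 - b.val) • y) -
        ((4 : ℕ) • x) := by
      have h' : b'.val • y + (4 - b.val) • y = (b'.val + 4 - b.val) • y := by
        rw [← add_nsmul]; congr 1; omega
      have h'' : a'.val • x + (4 - a'.val) • x = (4 : ℕ) • x := by
        rw [← add_nsmul, Nat.add_sub_cancel' (by omega)]
      rw [← h', ← h'']; abel
    rw [e1, e2, h, h4x, h4y]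
  -- reduce both coefficients modulo `4`
  have hk : ((a.val + 4 - a'.val) % 4) • x = ((b'.val + 4 - b.val) % 4) • y := by
    have e1 := mod_addOrderOf_nsmul x (a.val + 4 - a'.val)
    have e2 := mod_addOrderOf_nsmul y (b'.val + 4 - b.val)
    rw [hx] at e1
    rw [hy] at e2
    rw [e1, e2, key]
  have ha : a.val = a'.val := by
    have hk0 := hxy _ _ (Nat.mod_lt _ (by norm_num)) (Nat.mod_lt _ (by norm_num)) hk
    omega
  have hb : b.val = b'.val := by
    have hz : ((b'.val + 4 - b.val) % 4) • y = 0 := by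
      rw [← hk, show (a.val + 4 - a'.val) % 4 = 0 by omega, zero_smul]
    have hdvd : addOrderOf y ∣ (b'.val + 4 - b.val) % 4 := addOrderOf_dvd_of_nsmul_eq_zero hz
    rw [hy] at hdvd
    have := Nat.eq_zero_of_dvd_of_lt hdvd (Nat.mod_lt _ (by norm_num))
    omega
  exact Prod.ext (Fin.ext ha) (Fin.ext hb)

end Abstract

/-! ## §2 The curve `A : Y² = X³ + 4X`: its `2`-torsion and the three halves -/

section Curve

variable {H : Type} [Field H] [CharZero H]

/-- `negY x y = −y` on `A` (`a₁ = a₃ = 0`). [cite: TianYuanZhang2017, §3.1 (p0010 L11)] -/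
theorem curveA_negY (x y : H) : (curveA.baseChange H).toAffine.negY x y = -y := by
  obtain ⟨h1, -, h3, -, -⟩ := curveA_baseChange_a (H := H)
  rw [WeierstrassCurve.Affine.negY, h1, h3]; ring

/-- **An affine point of `A` is `2`-torsion iff its `Y`-coordinate vanishes.** [cite: SilvermanAEC2009, III.2.3] -/
theorem two_nsmul_some_eq_zero_iff {x y : H} (h : (curveA.baseChange H).toAffine.Nonsingular x y) :
    (2 : ℕ) • (Point.some x y h : APoint H) = 0 ↔ y = 0 := by
  constructor
  · intro h2
    by_contra hy
    have hy' : y ≠ (curveA.baseChange H).toAffine.negY x y := by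
      rw [curveA_negY]; intro e; apply hy; linear_combination e / 2
    rw [two_nsmul, Point.add_self_of_Y_ne hy'] at h2
    exact Point.some_ne_zero _ h2
  · intro hy
    rw [two_nsmul]
    exact Point.add_self_of_Y_eq (by rw [curveA_negY, hy, neg_zero])

/-- **The `2`-torsion `X`-coordinates are `0, 2i, −2i`**: `y = 0` and `x(x² + 4) = 0`. [cite: TianYuanZhang2017, Lemma 3.16 (p0017 L98–L101)] -/
theorem two_torsion_cases (im : H) (him : im ^ 2 = -1) {x y : H} (h : (curveA.baseChange H).toAffine.Nonsingular x y)
    (h2 : (2 : ℕ) • (Point.some x y h : APoint H) = 0) :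
    y = 0 ∧ (x = 0 ∨ x = 2 * im ∨ x = -(2 * im)) := by
  have hy : y = 0 := (two_nsmul_some_eq_zero_iff h).mp h2
  refine ⟨hy, ?_⟩
  have heq : y ^ 2 = x ^ 3 + 4 * x := (curveA_nonsingular_iff x y).mp h
  rw [hy] at heq
  have hx : x * (x - 2 * im) * (x + 2 * im) = 0 := by linear_combination (-1 : H) * heq + (-4 * x) * him
  rcases mul_eq_zero.mp hx with hx | hx
  · rcases mul_eq_zero.mp hx with hx | hx
    · exact Or.inl hx
    · exact Or.inr (Or.inl (by linear_combination hx))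
  · exact Or.inr (Or.inr (by linear_combination hx))

/-- `(2i, 0) ∈ A(H)`. [cite: TianYuanZhang2017, Lemma 3.16 (p0017 L98–L101)] -/
def ptTwoI (im : H) (him : im ^ 2 = -1) : APoint H :=
  .some (x := 2 * im) (y := 0) ((curveA_nonsingular_iff _ _).mpr (by linear_combination (-8 * im) * him))

/-- `(−2i, 0) ∈ A(H)`. [cite: TianYuanZhang2017, Lemma 3.16 (p0017 L98–L101)] -/
def ptNegTwoI (im : H) (him : im ^ 2 = -1) : APoint H :=
  .some (x := -(2 * im)) (y := 0) ((curveA_nonsingular_iff _ _).mpr (by linear_combination (8 * im) * him))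

/-- `[i](2i, 0) = (−2i, 0)`. [cite: TianYuanZhang2017, §3.1 (p0011 L66)] -/
theorem cmI_ptTwoI (im : H) (him : im ^ 2 = -1) : cmI im him (ptTwoI im him) = ptNegTwoI im him := by
  rw [ptTwoI, cmI_some, ptNegTwoI]
  simp only [mul_zero]

/-- `(2i, 0)` and `(−2i, 0)` are `2`-torsion. [cite: TianYuanZhang2017, Lemma 3.16 (p0017 L98–L101)] -/
theorem two_nsmul_ptTwoI (im : H) (him : im ^ 2 = -1) : (2 : ℕ) • ptTwoI im him = 0 :=
  (two_nsmul_some_eq_zero_iff _).mpr rfl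

/-- `(−2i, 0)` is `2`-torsion. [cite: TianYuanZhang2017, Lemma 3.16 (p0017 L98–L101)] -/
theorem two_nsmul_ptNegTwoI (im : H) (him : im ^ 2 = -1) : (2 : ℕ) • ptNegTwoI im him = 0 :=
  (two_nsmul_some_eq_zero_iff _).mpr rfl

/-- **`A(H)[2] = {O, (0,0), (2i,0), (−2i,0)}`**: every `2`-torsion point is one of the four. [cite: TianYuanZhang2017, Lemma 3.16 (p0017 L98–L101)] -/
theorem eq_of_two_nsmul_eq_zero (im : H) (him : im ^ 2 = -1) {Q : APoint H} (h2 : (2 : ℕ) • Q = 0) :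
    Q = 0 ∨ Q = tauOne ∨ Q = ptTwoI im him ∨ Q = ptNegTwoI im him := by
  rcases Q with _ | ⟨x, y, h⟩
  · exact Or.inl rfl
  · obtain ⟨hy, hx⟩ := two_torsion_cases im him h h2
    subst hy
    rcases hx with hx | hx | hx
    · subst hx; exact Or.inr (Or.inl rfl)
    · subst hx; exact Or.inr (Or.inr (Or.inl rfl))
    · subst hx; exact Or.inr (Or.inr (Or.inr rfl))

/-- `1 + s ≠ 0`, `2 + s ≠ 0`, `1 − i ≠ 0`, `i ≠ 0` for `s² = 2`, `i² = −1`. [cite: SilvermanAEC2009, III.2.3] -/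
theorem aux_ne_zero (im s : H) (him : im ^ 2 = -1) (hs : s ^ 2 = 2) :
    1 + s ≠ 0 ∧ 2 + s ≠ 0 ∧ 1 - im ≠ 0 ∧ im ≠ 0 := by
  refine ⟨fun e => ?_, fun e => ?_, fun e => ?_, fun e => ?_⟩
  · have : s ^ 2 = 1 := by linear_combination (s - 1) * e
    rw [hs] at this; norm_num at this
  · have : s ^ 2 = 4 := by linear_combination (s - 2) * e
    rw [hs] at this; norm_num at this
  · have : im ^ 2 = 1 := by linear_combination (-(im + 1)) * e
    rw [him] at this; norm_num at this
  · rw [e] at him; norm_num at him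

/-- **The half of `(2i, 0)`: `ptQ = (2i(1 + √2), (2√2 + 4)(1 − i))`** — on the curve:
`y² = −16i(1 + √2)² = x(x² + 4)`. [cite: TianYuanZhang2017, Lemma 3.18 (p0017 L152–L153)] [cite: SilvermanAEC2009, III.2.3] -/
def ptQ (im s : H) (him : im ^ 2 = -1) (hs : s ^ 2 = 2) : APoint H :=
  .some (x := 2 * im * (1 + s)) (y := (2 * s + 4) * (1 - im)) ((curveA_nonsingular_iff _ _).mpr (by
    linear_combination (-8 * im * s ^ 3 - 24 * im * s ^ 2 - 24 * im * s - 8 * im + 4 * s ^ 2 + 16 * s + 16) * him +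
      (8 * im * s + 16 * im) * hs))

/-- **`2·ptQ = (2i, 0)`**: the tangent at `ptQ` has slope `ℓ = −(1 + √2)(1 + i)`; `ℓ² − 2x = 2i` and
`ℓ(2i − x) + y = 0`. [cite: TianYuanZhang2017, Lemma 3.18 (p0017 L152–L153)] [cite: SilvermanAEC2009, III.2.3] -/
theorem two_nsmul_ptQ (im s : H) (him : im ^ 2 = -1) (hs : s ^ 2 = 2) :
    (2 : ℕ) • ptQ im s him hs = ptTwoI im him := by
  obtain ⟨hs1, hs2, hi1, hi0⟩ := aux_ne_zero im s him hs
  obtain ⟨h1, h2, h3, h4, -⟩ := curveA_baseChange_a (H := H)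
  set x : H := 2 * im * (1 + s) with hx
  set y : H := (2 * s + 4) * (1 - im) with hy
  have hy0 : y ≠ 0 := by
    rw [hy]; refine mul_ne_zero ?_ hi1
    intro e; apply hs2; linear_combination e / 2
  have hyne : y ≠ (curveA.baseChange H).toAffine.negY x y := by
    rw [curveA_negY]; intro e; apply hy0; linear_combination e / 2
  have hslope : (curveA.baseChange H).toAffine.slope x x y y = -(1 + s) * (1 + im) := by
    rw [WeierstrassCurve.Affine.slope_of_Y_ne rfl hyne, curveA_negY, h1, h2, h4]
    rw [div_eq_iff (by intro e; apply hy0; linear_combination e / 2)]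
    rw [hx, hy]
    linear_combination (8 * s ^ 2 + 12 * s + 4) * him + (-4 : H) * hs
  rw [two_nsmul, ptQ, Point.add_self_of_Y_ne hyne, ptTwoI]
  simp only [Point.some.injEq]
  refine ⟨?_, ?_⟩
  · rw [WeierstrassCurve.Affine.addX, hslope, h1, h2]
    linear_combination (s ^ 2 + 2 * s + 1) * him + (2 * im) * hs
  · rw [WeierstrassCurve.Affine.addY, WeierstrassCurve.Affine.negAddY, WeierstrassCurve.Affine.addX,
      curveA_negY, hslope, h1, h2]
    linear_combination (im * s ^ 3 + 3 * im * s ^ 2 + 3 * im * s + im + 3 * s ^ 3 + 3 * s ^ 2 - 3 * s - 3) * him +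
      (2 * im * s - 2 * s) * hs

/-- `4·ptQ = 0`. [cite: TianYuanZhang2017, Lemma 3.18 (p0017 L152–L153)] -/
theorem four_nsmul_ptQ (im s : H) (him : im ^ 2 = -1) (hs : s ^ 2 = 2) : (4 : ℕ) • ptQ im s him hs = 0 := by
  rw [show (4 : ℕ) = 2 * 2 by norm_num, mul_nsmul, two_nsmul_ptQ, two_nsmul_ptTwoI]

/-- `4·τ(1/2) = 0`. [cite: TianYuanZhang2017, §3.2 (p0012 L12–L18)] -/
theorem four_nsmul_tauHalf : (4 : ℕ) • (tauHalf : APoint H) = 0 := by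
  rw [show (4 : ℕ) = 2 * 2 by norm_num, mul_nsmul, two_nsmul_tauHalf, two_nsmul_tauOne]

/-- `2·[i]ptQ = (−2i, 0)`. [cite: TianYuanZhang2017, §3.1 (p0011 L66)] -/
theorem two_nsmul_cmI_ptQ (im s : H) (him : im ^ 2 = -1) (hs : s ^ 2 = 2) :
    (2 : ℕ) • cmI im him (ptQ im s him hs) = ptNegTwoI im him := by
  rw [← map_nsmul, two_nsmul_ptQ, cmI_ptTwoI]

/-! ## §3 The upper bound: `A(H)[4] ↪ A(H)[2] × A(H)[2]`, `#A(H)[2] ≤ 4` -/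

/-- `Fin 4` maps onto `A(H)[2]`. [cite: TianYuanZhang2017, Lemma 3.16 (p0017 L98–L101)] -/
theorem surjective_two_torsion (im : H) (him : im ^ 2 = -1) :
    Function.Surjective (fun i : Fin 4 => (⟨![0, tauOne, ptTwoI im him, ptNegTwoI im him] i, by
      fin_cases i
      · exact smul_zero _
      · exact two_nsmul_tauOne
      · exact two_nsmul_ptTwoI im him
      · exact two_nsmul_ptNegTwoI im him⟩ : {Q : APoint H // (2 : ℕ) • Q = 0})) := by
  rintro ⟨Q, hQ⟩
  rcases eq_of_two_nsmul_eq_zero im him hQ with h | h | h | h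
  · exact ⟨0, Subtype.ext h.symm⟩
  · exact ⟨1, Subtype.ext h.symm⟩
  · exact ⟨2, Subtype.ext h.symm⟩
  · exact ⟨3, Subtype.ext h.symm⟩

/-- `A(H)[2]` is finite with at most `4` elements. [cite: TianYuanZhang2017, Lemma 3.16 (p0017 L98–L101)] -/
theorem finite_two_torsion (im : H) (him : im ^ 2 = -1) : Finite {Q : APoint H // (2 : ℕ) • Q = 0} :=
  Finite.of_surjective _ (surjective_two_torsion im him)

/-- `#A(H)[2] ≤ 4`. [cite: TianYuanZhang2017, Lemma 3.16 (p0017 L98–L101)] [cite: SilvermanAEC2009, III.2.3] -/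
theorem card_two_torsion_le (im : H) (him : im ^ 2 = -1) : Nat.card {Q : APoint H // (2 : ℕ) • Q = 0} ≤ 4 := by
  have := Nat.card_le_card_of_surjective _ (surjective_two_torsion im him)
  rwa [Nat.card_fin] at this

/-- **A half of every `2`-torsion point**: `base(O) = O`, `base((0,0)) = τ(1/2)`, `base((2i,0)) = ptQ`,
`base((−2i,0)) = [i]ptQ`. [cite: TianYuanZhang2017, Lemma 3.18 (p0017 L152–L153)] -/
def baseHalf (im s : H) (him : im ^ 2 = -1) (hs : s ^ 2 = 2) (c : APoint H) : APoint H :=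
  if c = 0 then 0 else if c = tauOne then tauHalf else if c = ptTwoI im him then ptQ im s him hs
    else cmI im him (ptQ im s him hs)

/-- `2·base(c) = c` for every `2`-torsion `c`. [cite: TianYuanZhang2017, Lemma 3.18 (p0017 L152–L153)] -/
theorem two_nsmul_baseHalf (im s : H) (him : im ^ 2 = -1) (hs : s ^ 2 = 2) {c : APoint H}
    (hc : (2 : ℕ) • c = 0) : (2 : ℕ) • baseHalf im s him hs c = c := by
  unfold baseHalf
  rcases eq_of_two_nsmul_eq_zero im him hc with h | h | h | h
  · rw [if_pos h, h, smul_zero]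
  · have h0 : c ≠ 0 := by rw [h]; exact tauOne_ne_zero
    rw [if_neg h0, if_pos h, h, two_nsmul_tauHalf]
  · have h0 : c ≠ 0 := by rw [h, ptTwoI]; exact Point.some_ne_zero _
    have h1 : c ≠ tauOne := by
      rw [h, ptTwoI, tauOne]; intro e
      simp only [Point.some.injEq] at e
      have := e.1
      have hi : im = 0 := by linear_combination this / 2
      rw [hi] at him; norm_num at him
    rw [if_neg h0, if_neg h1, if_pos h, h, two_nsmul_ptQ]
  · have h0 : c ≠ 0 := by rw [h, ptNegTwoI]; exact Point.some_ne_zero _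
    have h1 : c ≠ tauOne := by
      rw [h, ptNegTwoI, tauOne]; intro e
      simp only [Point.some.injEq] at e
      have := e.1
      have hi : im = 0 := by linear_combination -this / 2
      rw [hi] at him; norm_num at him
    have h2 : c ≠ ptTwoI im him := by
      rw [h, ptNegTwoI, ptTwoI]; intro e
      simp only [Point.some.injEq] at e
      have := e.1
      have hi : im = 0 := by linear_combination -this / 4
      rw [hi] at him; norm_num at him
    rw [if_neg h0, if_neg h1, if_neg h2, h, two_nsmul_cmI_ptQ]

/-- **`A(H)[4] ↪ A(H)[2] × A(H)[2]`**, `Q ↦ (2Q, Q − base(2Q))`. [cite: TianYuanZhang2017, Lemma 3.18 (p0017 L152–L153)] -/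
def fourToTwoTwo (im s : H) (him : im ^ 2 = -1) (hs : s ^ 2 = 2) (Q : {Q : APoint H // (4 : ℕ) • Q = 0}) :
    {Q : APoint H // (2 : ℕ) • Q = 0} × {Q : APoint H // (2 : ℕ) • Q = 0} :=
  ⟨⟨(2 : ℕ) • Q.1, by rw [smul_smul]; exact Q.2⟩,
   ⟨Q.1 - baseHalf im s him hs ((2 : ℕ) • Q.1), by
      rw [smul_sub, two_nsmul_baseHalf im s him hs (by rw [smul_smul]; exact Q.2), sub_self]⟩⟩

/-- `Q ↦ (2Q, Q − base(2Q))` is injective. [cite: TianYuanZhang2017, Lemma 3.18 (p0017 L152–L153)] [cite: SilvermanAEC2009, III.6.4] -/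
theorem injective_fourToTwoTwo (im s : H) (him : im ^ 2 = -1) (hs : s ^ 2 = 2) :
    Function.Injective (fourToTwoTwo im s him hs) := by
  rintro ⟨Q, hQ⟩ ⟨Q', hQ'⟩ h
  simp only [fourToTwoTwo, Prod.mk.injEq, Subtype.mk.injEq] at h
  obtain ⟨h1, h2⟩ := h
  rw [h1] at h2
  exact Subtype.ext (sub_left_injective h2)

/-- `A(H)[4]` is finite. [cite: TianYuanZhang2017, Lemma 3.18 (p0017 L152–L153)] -/
theorem finite_four_torsion (im s : H) (him : im ^ 2 = -1) (hs : s ^ 2 = 2) :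
    Finite {Q : APoint H // (4 : ℕ) • Q = 0} :=
  haveI := finite_two_torsion im him
  Finite.of_injective _ (injective_fourToTwoTwo im s him hs)

/-- **`#A(H)[4] ≤ 16`.** [cite: TianYuanZhang2017, Lemma 3.18 (p0017 L152–L153)] -/
theorem four_torsion_card_le (im s : H) (him : im ^ 2 = -1) (hs : s ^ 2 = 2) :
    Nat.card {Q : APoint H // (4 : ℕ) • Q = 0} ≤ 16 := by
  haveI := finite_two_torsion im him
  have h := Nat.card_le_card_of_injective _ (injective_fourToTwoTwo im s him hs)
  rw [Nat.card_prod] at h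
  have h2 := card_two_torsion_le im him
  calc Nat.card {Q : APoint H // (4 : ℕ) • Q = 0} ≤ _ := h
    _ ≤ 4 * 4 := Nat.mul_le_mul h2 h2
    _ = 16 := by norm_num

/-! ## §4 The lower bound: `τ(1/2)` and `ptQ` span sixteen points -/

/-- `τ(1/2)` has additive order `4`. [cite: TianYuanZhang2017, §3.2 (p0012 L12–L18)] -/
theorem addOrderOf_tauHalf : addOrderOf (tauHalf : APoint H) = 4 := by
  haveI : Fact (Nat.Prime 2) := ⟨Nat.prime_two⟩
  have h := addOrderOf_eq_prime_pow (p := 2) (n := 1) (x := (tauHalf : APoint H)) (by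
    rw [pow_one, two_nsmul_tauHalf]; exact tauOne_ne_zero) (by
    rw [show (2 : ℕ) ^ (1 + 1) = 4 by norm_num]; exact four_nsmul_tauHalf)
  rw [h]; norm_num

/-- `ptQ` has additive order `4`. [cite: TianYuanZhang2017, Lemma 3.18 (p0017 L152–L153)] -/
theorem addOrderOf_ptQ (im s : H) (him : im ^ 2 = -1) (hs : s ^ 2 = 2) : addOrderOf (ptQ im s him hs) = 4 := by
  haveI : Fact (Nat.Prime 2) := ⟨Nat.prime_two⟩
  have h := addOrderOf_eq_prime_pow (p := 2) (n := 1) (x := ptQ im s him hs) (by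
    rw [pow_one, two_nsmul_ptQ, ptTwoI]; exact Point.some_ne_zero _) (by
    rw [show (2 : ℕ) ^ (1 + 1) = 4 by norm_num]; exact four_nsmul_ptQ im s him hs)
  rw [h]; norm_num

/-- The `X`-coordinates `2, 0` (multiples of `τ(1/2)`) and `2i(1 + √2), 2i` (multiples of `ptQ`) are distinct.
[cite: SilvermanAEC2009, III.2.3] -/
theorem X_ne_aux (im s : H) (him : im ^ 2 = -1) (hs : s ^ 2 = 2) :
    (2 : H) ≠ 2 * im * (1 + s) ∧ (2 : H) ≠ 2 * im ∧ (0 : H) ≠ 2 * im * (1 + s) ∧ (0 : H) ≠ 2 * im := by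
  obtain ⟨hs1, -, -, hi0⟩ := aux_ne_zero im s him hs
  refine ⟨fun e => ?_, fun e => ?_, fun e => ?_, fun e => ?_⟩
  · -- `1 = i(1 + s)` ⇒ `1 = −(3 + 2s)` ⇒ `s = −2`
    have h1 : (1 : H) = im * (1 + s) := by linear_combination e / 2
    have h2 : (1 : H) = im ^ 2 * (1 + s) ^ 2 := by linear_combination (1 + im * (1 + s)) * h1
    rw [him] at h2
    have h3 : s = -2 := by linear_combination (h2 - hs) / 2
    have : s ^ 2 = 4 := by rw [h3]; norm_num
    rw [hs] at this; norm_num at this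
  · have h1 : im = 1 := by linear_combination -e / 2
    rw [h1] at him; norm_num at him
  · exact mul_ne_zero (mul_ne_zero two_ne_zero hi0) hs1 e.symm
  · exact mul_ne_zero two_ne_zero hi0 e.symm

/-- **The multiples of `τ(1/2)` and of `ptQ` meet only in `O`**: `k • τ(1/2) = l • ptQ` with `k, l < 4` forces `k = 0`.
[cite: TianYuanZhang2017, Lemma 3.18 (p0017 L152–L153)] [cite: SilvermanAEC2009, III.2.3] -/
theorem nsmul_tauHalf_eq_nsmul_ptQ (im s : H) (him : im ^ 2 = -1) (hs : s ^ 2 = 2) :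
    ∀ k l : ℕ, k < 4 → l < 4 → k • (tauHalf : APoint H) = l • ptQ im s him hs → k = 0 := by
  obtain ⟨hA, hB, hC, hD⟩ := X_ne_aux im s him hs
  have hx3 : (3 : ℕ) • (tauHalf : APoint H) = -tauHalf := by
    apply eq_neg_of_add_eq_zero_left
    rw [← succ_nsmul, show (3 + 1 : ℕ) = 4 by norm_num]
    exact four_nsmul_tauHalf
  have hy3 : (3 : ℕ) • ptQ im s him hs = -ptQ im s him hs := by
    apply eq_neg_of_add_eq_zero_left
    rw [← succ_nsmul, show (3 + 1 : ℕ) = 4 by norm_num]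
    exact four_nsmul_ptQ im s him hs
  -- the `X`-coordinates
  have hX_tau : ∀ k : ℕ, k < 4 → k ≠ 0 → ∃ y h, k • (tauHalf : APoint H) = Point.some (if k = 2 then 0 else 2) y h := by
    intro k hk hk0
    interval_cases k
    · exact absurd rfl hk0
    · exact ⟨4, _, by rw [one_nsmul, tauHalf]; rfl⟩
    · exact ⟨0, _, by rw [two_nsmul_tauHalf, tauOne]; rfl⟩
    · exact ⟨_, _, by rw [hx3, tauHalf, Point.neg_some]; rfl⟩
  have hX_Q : ∀ l : ℕ, l < 4 → l ≠ 0 → ∃ y h, l • ptQ im s him hs =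
      Point.some (if l = 2 then 2 * im else 2 * im * (1 + s)) y h := by
    intro l hl hl0
    interval_cases l
    · exact absurd rfl hl0
    · exact ⟨_, _, by rw [one_nsmul, ptQ]; rfl⟩
    · exact ⟨0, _, by rw [two_nsmul_ptQ, ptTwoI]; rfl⟩
    · exact ⟨_, _, by rw [hy3, ptQ, Point.neg_some]; rfl⟩
  intro k l hk hl h
  by_contra hk0
  by_cases hl0 : l = 0
  · -- `k • τ(1/2) = 0` forces `4 ∣ k`
    rw [hl0, zero_smul] at h
    have hdvd : addOrderOf (tauHalf : APoint H) ∣ k := addOrderOf_dvd_of_nsmul_eq_zero h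
    rw [addOrderOf_tauHalf] at hdvd
    exact hk0 (Nat.eq_zero_of_dvd_of_lt hdvd hk)
  obtain ⟨y₁, h₁, e₁⟩ := hX_tau k hk hk0
  obtain ⟨y₂, h₂, e₂⟩ := hX_Q l hl hl0
  rw [e₁, e₂] at h
  simp only [Point.some.injEq] at h
  have hX := h.1
  split_ifs at hX
  · exact hD hX
  · exact hC hX
  · exact hB hX
  · exact hA hX

/-- **`16 ≤ #A(H)[4]`**: `(a, b) ↦ a·τ(1/2) + b·ptQ` is injective on `Fin 4 × Fin 4`.
[cite: TianYuanZhang2017, Lemma 3.18 (p0017 L152–L153)] [cite: SilvermanAEC2009, III.6.4] -/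
theorem four_torsion_card_ge (im s : H) (him : im ^ 2 = -1) (hs : s ^ 2 = 2) :
    16 ≤ Nat.card {Q : APoint H // (4 : ℕ) • Q = 0} := by
  haveI := finite_four_torsion im s him hs
  let f : Fin 4 × Fin 4 → {Q : APoint H // (4 : ℕ) • Q = 0} := fun p =>
    ⟨(p.1 : ℕ) • (tauHalf : APoint H) + (p.2 : ℕ) • ptQ im s him hs, by
      rw [smul_add, smul_comm (4 : ℕ) (p.1 : ℕ), smul_comm (4 : ℕ) (p.2 : ℕ), four_nsmul_tauHalf,
        four_nsmul_ptQ, smul_zero, smul_zero, add_zero]⟩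
  have hf : Function.Injective f := by
    intro p p' h
    have h' := congrArg Subtype.val h
    exact injective_nsmul_add_nsmul_of_addOrderOf_four addOrderOf_tauHalf (addOrderOf_ptQ im s him hs)
      (nsmul_tauHalf_eq_nsmul_ptQ im s him hs) h'
  have := Nat.card_le_card_of_injective f hf
  rwa [Nat.card_prod, Nat.card_fin] at this

/-- **`#A(H)[4] = 16`** for every field `H` of characteristic `0` containing `i` and `√2`: the half
«`A[4] ⊆ A(ℍ′_n)`» of Lemma 3.18's «`A(ℍ′_n)_tor = A[4]`» (`n` even) is a kernel theorem of `i, √2 ∈ ℍ′_n`.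
[cite: TianYuanZhang2017, Lemma 3.18 (p0017 L152–L153)] [cite: SilvermanAEC2009, III.2.3, III.6.4] -/
theorem card_four_torsion_eq_sixteen (im s : H) (him : im ^ 2 = -1) (hs : s ^ 2 = 2) :
    Nat.card {Q : APoint H // (4 : ℕ) • Q = 0} = 16 :=
  le_antisymm (four_torsion_card_le im s him hs) (four_torsion_card_ge im s him hs)

end Curve

/-! ## §5 On the data `D`: for `n` even, `√2 = i·√−2 ∈ ℍ′_n` and `#A(ℍ′_n)[4] = 16` -/

namespace GenusPointData

variable {n : ℕ}

/-- **The «`#A(ℍ′_n)[4] = 16`» half of Lemma 3.18 (`n` even) from the data's `i` and `√−2`**: `√2 := i·√−2 ∈ ℍ′_n`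
(`2 ∣ n`), and the curve's sixteen `4`-torsion points are rational over `ℚ(i, √2)`.
[cite: TianYuanZhang2017, Lemma 3.18 (p0017 L152–L153), §3.1 (p0011 L60–L64: `√−d ∈ ℍ′_n` for `d ∣ n`)] -/
theorem card_four_torsion_of_data (D : GenusPointData n) (hn : n ≠ 0) (heven : Even n) :
    Nat.card {Q : APoint D.H // (4 : ℕ) • Q = 0} = 16 := by
  have h2 : 2 ∈ n.divisors := Nat.mem_divisors.mpr ⟨even_iff_two_dvd.mp heven, hn⟩
  have hs : (D.im * D.sqrtNeg 2) ^ 2 = 2 := by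
    rw [mul_pow, D.im_sq, D.sqrtNeg_sq 2 h2]; push_cast; ring
  exact card_four_torsion_eq_sixteen D.im (D.im * D.sqrtNeg 2) D.im_sq hs

end GenusPointData

end Literature.NumberTheory.EllipticCurves.TianYuanZhang2017

end
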